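import Summits.ResolutionOfSingularities.ResolutionOfSingularities.Theorems.EquisingularLiftEquisingularLiftNatTowerInvThreePointCentre
import Summits.ResolutionOfSingularities.ResolutionOfSingularities.Theorems.EquisingularLiftEquisingularLiftNatTowerRuledPointSteps
import Summits.ResolutionOfSingularities.ResolutionOfSingularities.Theorems.EquisingularLiftEquisingularLiftNatTowerReachTwoDefs
import Summits.ResolutionOfSingularities.ResolutionOfSingularities.Theorems.EquisingularLiftEquisingularLiftNatModelPointStep
import Summits.ResolutionOfSingularities.ResolutionOfSingularities.Theorems.EquisingularLiftEquisingularLiftNatModelPointStepOfSection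
import Summits.ResolutionOfSingularities.ResolutionOfSingularities.Theorems.EquisingularLiftEquisingularLiftNatBlowupDisjointTransport
import HarnessLib

/-!
# [OURS · L1 W4.5(b) · EL♮(3)] Rung TOWER₄ — THE (pt-ram) AND (pt-reg) CLAUSES OF THE DRIVER AT `INV₁ := Tower.Inv₃` (localized shadow trace),
# with and without the ruled-datum transport stand-in: `Tower.towerPtRam₂_inv₃`, `Tower.towerPtReg₂_inv₃`, `DirLift.towerPtRam₂_inv₃`, `DirLift.towerPtReg₂_inv₃`
# (crux `EquisingularLiftNatThree` = stmt-ResolutionOfSingularities-20148, parent stmt-…-20038; registered stub `stub_elnat_coneTowerPointResolution` @ `ReachTower₄`)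

HONEST FRAMING. OURS (cell res-hironaka, crux chain w45b, slot W4.5(b)); NOT a statement of any manuscript; AI-written, weaker than expert
review. Helper `--supports stmt-ResolutionOfSingularities-20148 --as helper`; closes nothing; no `sorry`; standard axioms; DEF-FREE.
res-L1-w45b-stub-4 g8, object (R-a) of res-D-pv-029's retarget list (STATUS 2026-08-27T20:58:53Z): the `Tower.Inv₃` TWINS, proofs verbatim
over the three centre-agnostic lemmas `Tower.inv₃_pointCentre_new/_transport/_forget` (…NatTowerInvThreePointCentre), of
* res-L1-w45b-stub-4 …NatTowerPtRamInvTwo p560137 (`Tower.exists_ptRam_stage₃`, `Tower.inv₃_ptRam_new/_transport/_forget`, `Tower.towerPtRam₂_inv₃`),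
* res-D-pv-029 …NatTowerPtRegInvTwo p562007 (`Tower.towerPtReg₂_inv₃`),
* res-L1-w45b-stub-2 …NatTowerRuledPointSteps p562864 / …Reg p565341 (`DirLift.towerPtRam₂_inv₃`, `DirLift.towerPtReg₂_inv₃` at
  `Ruled := DirLift.Ruled O k θ P q Y`, stand-in discharged by stub-2's `DirLift.ruled_of_step_away`).
The constructors `TowerPtRam₂` / `TowerPtReg₂` are UNCHANGED at `₄` (lead-2 …NatTowerRoundThreeDefs), so these are exactly the (pt-ram)/(pt-reg)
hypotheses of the TOWER₄ driver at `INV₁ := Tower.Inv₃ … (DirLift.Ruled …)`.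

References (index only): res-D-pv-029 …NatTowerInvDefs v3 p570397, …NatTowerPtRegInvTwo p562007, …NatModelPointStep(OfSection);
res-L1-w45b-stub-4 …NatTowerPtRamInvTwo p560137, …NatTowerPtRamMember p552505 (`fatPointStep_model`); res-L1-w45b-stub-2 p562864 / p565341;
res-L1-w45b-lead-2 …NatTowerReachTwoDefs (`TowerPtRam₂`, `TowerPtReg₂`). [cite: Liu2002, §8.1 and Thm. 8.1.19] [cite: GortzWedhorn2020, Prop. 13.91 (3) and (13.19)]
-/

set_option linter.dupNamespace false -- mandated namespace `Summit.<Summit>.<Problem>` of this single-conjunct summit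
set_option linter.overlappingInstances false -- the binders carry `[IsDomain O] [IsDiscreteValuationRing O]`

noncomputable section

open CategoryTheory CategoryTheory.Limits AlgebraicGeometry TopologicalSpace Topology IsLocalRing
open Literature.AlgebraicGeometry.Resolution
open AlgebraicGeometry.Scheme.IdealSheafData
open Summit.ResolutionOfSingularities.ResolutionOfSingularities.Theses.EquisingularLift.Split
open Summit.ResolutionOfSingularities.ResolutionOfSingularities.Cruxes.EquisingularLift.StrataSplit

namespace Summit.ResolutionOfSingularities.ResolutionOfSingularities.Cruxes.EquisingularLiftNat.Sections

/-! ## (pt-ram) -/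

section PtRamThree

variable (O : Type) [CommRing O] [IsDomain O] [IsDiscreteValuationRing O] [IsAdicComplete (maximalIdeal O) O]
  [IsAlgClosed (ResidueField O)] (k : Type) [Field k] (θ : O →+* k) (hθ : Function.Surjective θ)
  (P : Scheme.{0}) (q : P ⟶ Spec (.of O)) (Y : Set P) (hYsp : Y ⊆ q ⁻¹' {closedPoint O}) (hYirr : IsIrreducible Y)
  (hYcl : IsClosed Y) [IsProper q] [IsIntegral P] (hPnoeth : IsLocallyNoetherian P) (hPreg : Scheme.IsRegular P)
  (n : ℕ) [SmoothOfRelativeDimension n q]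
  (Ch : ∀ X' : Scheme.{0}, (X' ⟶ P) → Set X' → Prop)
  (hChain : ∀ (X' : Scheme.{0}) (σ : X' ⟶ P) (S : Set X'), Ch X' σ S → Chain P Y X' σ S)
  (hStep : ∀ (X' X'' : Scheme.{0}) (σ' : X' ⟶ P) (S' : Set X') (C : X'.IdealSheafData) (τ : X'' ⟶ X'),
    Ch X' σ' S' → IsBlowup τ C → Scheme.IsRegular C.subscheme → Flat (C.subschemeι ≫ σ' ≫ q) →
    σ' '' (C.support : Set X') ⊆ {x : P | ¬ IsGenericPoint x Y} →
    (C.support : Set X') ∩ (σ' ≫ q) ⁻¹' {closedPoint O} ⊆ S' →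
    Ch X'' (τ ≫ σ') (closure (τ ⁻¹' (S' \ (C.support : Set X')))))
  (Ruled : Tower.RuledDatum P)
  {F₉ : Scheme.{0}} {Z₉ : Set F₉} {hZ₉ : IsClosed Z₉} {F₁₀ : Scheme.{0}} {υ' : F₁₀ ⟶ F₉}
  (hRuled : ∀ (G₀ G₀' : Scheme.{0}) (γ₀ : G₀ ⟶ F₁₀) (E₀ : Set G₀) (X₀ X₀'' : Scheme.{0}) (σ₀ : X₀ ⟶ P) (j₀ : G₀ ⟶ X₀)
      (j₀' : G₀' ⟶ X₀'') (t₀' : G₀' ⟶ Spec (.of k)) (𝓔₀ : X₀.IdealSheafData) (τ₀ : X₀'' ⟶ X₀) (υ₀ : G₀' ⟶ G₀) (y₀ : G₀),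
    j₀' ≫ τ₀ = υ₀ ≫ j₀ → IsPullback j₀' t₀' ((τ₀ ≫ σ₀) ≫ q) (Spec.map (CommRingCat.ofHom θ)) → y₀ ∉ E₀ →
    (∃ e : (𝓔₀.comap τ₀).subscheme ≅ 𝓔₀.subscheme, e.hom ≫ 𝓔₀.subschemeι = (𝓔₀.comap τ₀).subschemeι ≫ τ₀) →
    Ruled F₉ Z₉ hZ₉ F₁₀ υ' G₀ γ₀ E₀ X₀ σ₀ j₀ 𝓔₀ →
    Ruled F₉ Z₉ hZ₉ F₁₀ υ' G₀' (υ₀ ≫ γ₀) (closure (υ₀ ⁻¹' (E₀ \ {y₀}))) X₀'' (τ₀ ≫ σ₀) j₀' (𝓔₀.comap τ₀))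
  {G G' : Scheme.{0}} {γ : G ⟶ F₁₀} {T E K : Set G}
  (y : redSub G (closure T) isClosed_closure) (J : G.IdealSheafData) (υ₂ : G' ⟶ G)
  (hinv : Tower.Inv₃ O k θ P q Y Ch Ruled F₉ Z₉ hZ₉ F₁₀ υ' G γ T E K)
  (hTreg : ¬ IsRegularLocalRing ((redSub G (closure T) isClosed_closure).presheaf.stalk y))
  (hJsupp : (J.support : Set G) = {curvePt G T y})
  (hJgen : ∃ (ℓ : Fin n → G.presheaf.stalk (curvePt G T y))
      (hℓ : ∀ i, ℓ i ∈ maximalIdeal (G.presheaf.stalk (curvePt G T y))),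
    stalkIdeal J (curvePt G T y) = Ideal.span (Set.range ℓ) ∧
    LinearIndependent (ResidueField (G.presheaf.stalk (curvePt G T y)))
      (fun i => (maximalIdeal (G.presheaf.stalk (curvePt G T y))).toCotangent ⟨ℓ i, hℓ i⟩))
  (hυ₂ : IsBlowup υ₂ J)

include hθ hYsp hYirr hYcl hPnoeth hPreg hChain hStep hinv hTreg hJsupp hJgen hυ₂

/-- The shared preamble: the (pt-ram) stage step with its bookkeeping and the inputs of the centre-agnostic lemmas, from `Tower.Inv₃`'s stage.
[cite: Liu2002, §8.1 and Thm. 8.1.19] [OURS · L1 W4.5b · towerPtRam_brick] -/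
theorem Tower.exists_ptRam_stage₃ :
    ∃ (X : Scheme.{0}) (σ : X ⟶ P) (jG : G ⟶ X) (C : X.IdealSheafData) (X'' : Scheme.{0}) (τ : X'' ⟶ X)
      (j₂ : G' ⟶ X'') (t₂ : G' ⟶ Spec (.of k)),
      IsBlowup υ' (vanishingIdeal (⟨Z₉, hZ₉⟩ : Closeds F₉)) ∧ Z₉.Infinite ∧ IsIntegral G ∧ IsIrreducible T ∧ IsClosed E ∧ ¬ T ⊆ E ∧
      (∀ hE : IsClosed E, Tower.Exc₃ O P q Y Ruled Z₉ hZ₉ υ' G γ E hE K X σ jG) ∧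
      IsClosed ({curvePt G T y} : Set G) ∧ ¬ T ⊆ {curvePt G T y} ∧ IsLocallyNoetherian G ∧ IsLocallyNoetherian X ∧
      IsLocallyNoetherian X'' ∧ IsBlowup τ C ∧
      (∀ I : X.IdealSheafData, jG (curvePt G T y) ∉ (I.support : Set X) → Disjoint (I.support : Set X) (C.support : Set X)) ∧
      j₂ ≫ τ = υ₂ ≫ jG ∧ Ch X'' (τ ≫ σ) (closure (τ ⁻¹' ((jG '' T) \ (C.support : Set X)))) ∧ IsIntegral X'' ∧
      Scheme.IsRegular X'' ∧ IsDominant ((τ ≫ σ) ≫ q) ∧ IsPullback j₂ t₂ ((τ ≫ σ) ≫ q) (Spec.map (CommRingCat.ofHom θ)) ∧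
      j₂ '' closure (υ₂ ⁻¹' (T \ {curvePt G T y})) = closure (τ ⁻¹' ((jG '' T) \ (C.support : Set X))) ∧ IsIntegral G' ∧
      IsIrreducible (closure (υ₂ ⁻¹' (T \ {curvePt G T y}))) := by
  classical
  obtain ⟨hυ', hZ₉inf, hGint, hTcl, hTirr, hEcl, hTE, X, σ, S, jG, tG, hCh, hXint, hXnoeth, hXreg, hdom, hsq, hTS, hExc⟩ := hinv
  haveI := hGint
  haveI := hXint
  haveI := hXnoeth
  have hyT : curvePt G T y ∈ T := subschemeι_mem_of_isClosed hTcl y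
  have hyc : IsClosed ({curvePt G T y} : Set G) := hJsupp ▸ J.support.isClosed
  have hTy : ¬ T ⊆ {curvePt G T y} := not_subset_singleton_of_not_isRegularLocalRing_stalk y hTreg hyc
  haveI : IsClosedImmersion (Spec.map (CommRingCat.ofHom θ)) := IsClosedImmersion.spec_of_surjective _ hθ
  haveI hjci : IsClosedImmersion jG := MorphismProperty.IsStableUnderBaseChange.of_isPullback hsq.flip inferInstance
  have hjyc : IsClosed ({jG (curvePt G T y)} : Set X) := by
    simpa only [Set.image_singleton] using hjci.isClosedEmbedding.isClosedMap _ hyc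
  have hyoff : ¬ IsGenericPoint (σ (jG (curvePt G T y))) Y :=
    not_isGenericPoint_of_image_eq (hChain _ _ _ hCh) jG hjci.isClosedEmbedding.injective hTS hjyc hTy
  obtain ⟨ℓ, hℓ, hJℓ, hli⟩ := hJgen
  obtain ⟨C, X'', τ, j₂, t₂, hτ, -, -, -, -, hdisj, hCh'', hreg'', hnoeth'', hint'', hdom'', -, -, hGnoeth, hG'int, -, hT'irr,
      hsq₂, hcomm, hsets⟩ :=
    fatPointStep_model O k θ hθ P q Y hYsp hYirr hYcl hPnoeth hPreg n Ch hChain hStep X σ S hCh hdom G jG tG hsq T hTS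
      (curvePt G T y) hyT hTy hyoff J hJsupp ℓ hℓ hJℓ hli G' υ₂ hυ₂
  subst hTS
  exact ⟨X, σ, jG, C, X'', τ, j₂, t₂, hυ', hZ₉inf, hGint, hTirr, hEcl, hTE, hExc, hyc, hTy, hGnoeth, hXnoeth, hnoeth'', hτ, hdisj, hcomm,
    hCh'', hint'', hreg'', hdom'', hsq₂, hsets, hG'int, hT'irr⟩

/-- **(pt-ram) on `Tower.Inv₃`, NEW PLANE** (any `K′`). [cite: Liu2002, §8.1 and Thm. 8.1.19] [OURS · L1 W4.5b · towerPtRam_brick toward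
`stub_elnat_coneTowerPointResolution`; NOT a statement of the manuscript] -/
theorem Tower.inv₃_ptRam_new (K' : Set G') :
    Tower.Inv₃ O k θ P q Y Ch Ruled F₉ Z₉ hZ₉ F₁₀ υ' G' (υ₂ ≫ γ) (closure (υ₂ ⁻¹' (T \ {curvePt G T y})))
      (υ₂ ⁻¹' {curvePt G T y}) K' := by
  obtain ⟨X, σ, jG, C, X'', τ, j₂, t₂, hυ', hZ₉inf, hGint, -, -, -, -, hyc, hTy, hGnoeth, -, hnoeth'', -, -, -, hCh'', hint'', hreg'',
    hdom'', hsq₂, hsets, hG'int, hT'irr⟩ :=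
    Tower.exists_ptRam_stage₃ O k θ hθ P q Y hYsp hYirr hYcl hPnoeth hPreg n Ch hChain hStep Ruled y J υ₂ hinv hTreg hJsupp hJgen hυ₂
  haveI := hGint; haveI := hGnoeth; haveI := hnoeth''; haveI := hint''; haveI := hG'int
  exact Tower.inv₃_pointCentre_new O k θ P q Y Ch Ruled hυ' hZ₉inf hyc hTy hJsupp hυ₂ hCh'' hreg'' hdom'' hsq₂ hsets hT'irr K'

include hRuled in
/-- **(pt-ram) on `Tower.Inv₃`, TRANSPORTED SURFACE, SHADOW CARRIED** (under «`NoRound ∨ y ∉ E`», «`K = ∅ ∨ y ∉ closure K`», `hRuled`).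
[cite: GortzWedhorn2020, Prop. 13.91 (3) and (13.19)] [cite: StacksProject, Tag 033B] [OURS · L1 W4.5b · towerPtRam_brick toward
`stub_elnat_coneTowerPointResolution`; NOT a statement of the manuscript] -/
theorem Tower.inv₃_ptRam_transport (hE : Tower.NoRound υ' G γ E ∨ curvePt G T y ∉ E) (hK : K = ∅ ∨ curvePt G T y ∉ closure K) :
    Tower.Inv₃ O k θ P q Y Ch Ruled F₉ Z₉ hZ₉ F₁₀ υ' G' (υ₂ ≫ γ) (closure (υ₂ ⁻¹' (T \ {curvePt G T y})))
      (closure (υ₂ ⁻¹' (E \ {curvePt G T y}))) (closure (υ₂ ⁻¹' (K \ {curvePt G T y}))) := by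
  obtain ⟨X, σ, jG, C, X'', τ, j₂, t₂, hυ', hZ₉inf, hGint, hTirr, hEcl, hTE, hExc, hyc, hTy, hGnoeth, hXnoeth, hnoeth'', hτ, hdisj,
    hcomm, hCh'', hint'', hreg'', hdom'', hsq₂, hsets, hG'int, hT'irr⟩ :=
    Tower.exists_ptRam_stage₃ O k θ hθ P q Y hYsp hYirr hYcl hPnoeth hPreg n Ch hChain hStep Ruled y J υ₂ hinv hTreg hJsupp hJgen hυ₂
  haveI := hGint; haveI := hGnoeth; haveI := hXnoeth; haveI := hnoeth''; haveI := hint''; haveI := hG'int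
  exact Tower.inv₃_pointCentre_transport O k θ P q Y Ch Ruled hυ' hZ₉inf hTirr hEcl hTE hExc hyc hTy hJsupp hυ₂ hτ hdisj hcomm hCh''
    hreg'' hdom'' hsq₂ hsets hT'irr hRuled hE hK

include hRuled in
/-- **(pt-ram) on `Tower.Inv₃`, TRANSPORTED SURFACE, SHADOW FORGOTTEN.** [cite: GortzWedhorn2020, Prop. 13.91 (3)] [OURS · L1 W4.5b ·
towerPtRam_brick toward `stub_elnat_coneTowerPointResolution`; NOT a statement of the manuscript] -/
theorem Tower.inv₃_ptRam_forget (hE : Tower.NoRound υ' G γ E ∨ curvePt G T y ∉ E) :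
    Tower.Inv₃ O k θ P q Y Ch Ruled F₉ Z₉ hZ₉ F₁₀ υ' G' (υ₂ ≫ γ) (closure (υ₂ ⁻¹' (T \ {curvePt G T y})))
      (closure (υ₂ ⁻¹' (E \ {curvePt G T y}))) ∅ := by
  obtain ⟨X, σ, jG, C, X'', τ, j₂, t₂, hυ', hZ₉inf, hGint, hTirr, hEcl, hTE, hExc, hyc, hTy, hGnoeth, hXnoeth, hnoeth'', hτ, hdisj,
    hcomm, hCh'', hint'', hreg'', hdom'', hsq₂, hsets, hG'int, hT'irr⟩ :=
    Tower.exists_ptRam_stage₃ O k θ hθ P q Y hYsp hYirr hYcl hPnoeth hPreg n Ch hChain hStep Ruled y J υ₂ hinv hTreg hJsupp hJgen hυ₂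
  haveI := hGint; haveI := hGnoeth; haveI := hXnoeth; haveI := hnoeth''; haveI := hint''; haveI := hG'int
  exact Tower.inv₃_pointCentre_forget O k θ P q Y Ch Ruled hυ' hZ₉inf hTirr hEcl hTE hExc hyc hTy hJsupp hυ₂ hτ hdisj hcomm hCh''
    hreg'' hdom'' hsq₂ hsets hT'irr hRuled hE

end PtRamThree

/-- **THE (pt-ram) CLAUSE OF THE TOWER DRIVER AT `INV₁ := Tower.Inv₃`**: `TowerPtRam₂ F₉ F₁₀ υ' (Tower.Inv₃ O k θ P q Y Ch Ruled F₉ Z₉ hZ₉ F₁₀ υ')`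
modulo the ruled-datum transport hypothesis `hRuled` (see the module docstring). The case split over the `TowerPtRam₂` menus: new plane
(`Tower.inv₃_ptRam_new`), transported surface with the shadow forgotten (`…_forget`) or carried (`…_transport`). [cite: Liu2002, §8.1 and
Thm. 8.1.19] [cite: GortzWedhorn2020, Prop. 13.91 (3) and (13.19)] [OURS · L1 W4.5b · towerPtRam_brick = hypothesis (pt-ram) of res-D-pv-029's
the TOWER₄ driver toward `stub_elnat_coneTowerPointResolution` (stmt-ResolutionOfSingularities-20148 / -20038); NOT a statement of
the manuscript] -/
theorem Tower.towerPtRam₂_inv₃ (O : Type) [CommRing O] [IsDomain O] [IsDiscreteValuationRing O] [IsAdicComplete (maximalIdeal O) O]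
    [IsAlgClosed (ResidueField O)] (k : Type) [Field k] (θ : O →+* k) (hθ : Function.Surjective θ)
    (P : Scheme.{0}) (q : P ⟶ Spec (.of O)) (Y : Set P) (hYsp : Y ⊆ q ⁻¹' {closedPoint O}) (hYirr : IsIrreducible Y)
    (hYcl : IsClosed Y) [IsProper q] [IsIntegral P] (hPnoeth : IsLocallyNoetherian P) (hPreg : Scheme.IsRegular P)
    [SmoothOfRelativeDimension 3 q]
    (Ch : ∀ X' : Scheme.{0}, (X' ⟶ P) → Set X' → Prop)
    (hChain : ∀ (X' : Scheme.{0}) (σ : X' ⟶ P) (S : Set X'), Ch X' σ S → Chain P Y X' σ S)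
    (hStep : ∀ (X' X'' : Scheme.{0}) (σ' : X' ⟶ P) (S' : Set X') (C : X'.IdealSheafData) (τ : X'' ⟶ X'),
      Ch X' σ' S' → IsBlowup τ C → Scheme.IsRegular C.subscheme → Flat (C.subschemeι ≫ σ' ≫ q) →
      σ' '' (C.support : Set X') ⊆ {x : P | ¬ IsGenericPoint x Y} →
      (C.support : Set X') ∩ (σ' ≫ q) ⁻¹' {closedPoint O} ⊆ S' →
      Ch X'' (τ ≫ σ') (closure (τ ⁻¹' (S' \ (C.support : Set X')))))
    (Ruled : Tower.RuledDatum P) (F₉ : Scheme.{0}) (Z₉ : Set F₉) (hZ₉ : IsClosed Z₉) (F₁₀ : Scheme.{0}) (υ' : F₁₀ ⟶ F₉)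
    (hRuled : ∀ (G₀ G₀' : Scheme.{0}) (γ₀ : G₀ ⟶ F₁₀) (E₀ : Set G₀) (X₀ X₀'' : Scheme.{0}) (σ₀ : X₀ ⟶ P) (j₀ : G₀ ⟶ X₀)
        (j₀' : G₀' ⟶ X₀'') (t₀' : G₀' ⟶ Spec (.of k)) (𝓔₀ : X₀.IdealSheafData) (τ₀ : X₀'' ⟶ X₀) (υ₀ : G₀' ⟶ G₀) (y₀ : G₀),
      j₀' ≫ τ₀ = υ₀ ≫ j₀ → IsPullback j₀' t₀' ((τ₀ ≫ σ₀) ≫ q) (Spec.map (CommRingCat.ofHom θ)) → y₀ ∉ E₀ →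
      (∃ e : (𝓔₀.comap τ₀).subscheme ≅ 𝓔₀.subscheme, e.hom ≫ 𝓔₀.subschemeι = (𝓔₀.comap τ₀).subschemeι ≫ τ₀) →
      Ruled F₉ Z₉ hZ₉ F₁₀ υ' G₀ γ₀ E₀ X₀ σ₀ j₀ 𝓔₀ →
      Ruled F₉ Z₉ hZ₉ F₁₀ υ' G₀' (υ₀ ≫ γ₀) (closure (υ₀ ⁻¹' (E₀ \ {y₀}))) X₀'' (τ₀ ≫ σ₀) j₀' (𝓔₀.comap τ₀)) :
    TowerPtRam₂ F₉ F₁₀ υ' (Tower.Inv₃ O k θ P q Y Ch Ruled F₉ Z₉ hZ₉ F₁₀ υ') := by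
  intro G G' γ T E K y J υ₂ K' E' hinv hTreg _hGreg hJsupp hJgen hυ₂ hK' hE'
  rcases hE' with rfl | ⟨hside, rfl⟩
  · exact Tower.inv₃_ptRam_new O k θ hθ P q Y hYsp hYirr hYcl hPnoeth hPreg 3 Ch hChain hStep Ruled y J υ₂ hinv hTreg hJsupp hJgen
      hυ₂ K'
  · have hE : Tower.NoRound υ' G γ E ∨ curvePt G T y ∉ E := hside
    rcases hK' with rfl | ⟨hyK, rfl⟩
    · exact Tower.inv₃_ptRam_forget O k θ hθ P q Y hYsp hYirr hYcl hPnoeth hPreg 3 Ch hChain hStep Ruled hRuled y J υ₂ hinv hTreg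
        hJsupp hJgen hυ₂ hE
    · exact Tower.inv₃_ptRam_transport O k θ hθ P q Y hYsp hYirr hYcl hPnoeth hPreg 3 Ch hChain hStep Ruled hRuled y J υ₂ hinv hTreg
        hJsupp hJgen hυ₂ hE (Or.inr hyK)


/-! ## (pt-reg) -/

/-- **THE (pt-reg) CLAUSE OF THE TOWER DRIVER AT `INV₁ := Tower.Inv₃`**: `TowerPtReg₂ F₉ F₁₀ υ' (Tower.Inv₃ O k θ P q Y Ch Ruled F₉ Z₉ hZ₉ F₁₀ υ')`
modulo the ruled-datum transport hypothesis `hRuled` (interface `ruled_of_step_away`). Case split over the `TowerPtReg₂` menus.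
[cite: Liu2002, §8.1 and Thm. 8.1.19] [cite: GortzWedhorn2020, Prop. 13.91 (3) and (13.19)] [OURS · L1 W4.5b · hypothesis (pt-reg) of
the TOWER₄ driver toward `stub_elnat_coneTowerPointResolution` (stmt-ResolutionOfSingularities-20148 / -20038); NOT a statement of
the manuscript] -/
theorem Tower.towerPtReg₂_inv₃ (O : Type) [CommRing O] [IsDomain O] [IsDiscreteValuationRing O] [IsAdicComplete (maximalIdeal O) O]
    [IsAlgClosed (ResidueField O)] (k : Type) [Field k] (θ : O →+* k) (hθ : Function.Surjective θ)
    (P : Scheme.{0}) (q : P ⟶ Spec (.of O)) (Y : Set P) (hYsp : Y ⊆ q ⁻¹' {closedPoint O}) (hYirr : IsIrreducible Y)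
    (hYcl : IsClosed Y) [IsProper q] (hPnoeth : IsLocallyNoetherian P) (hPreg : Scheme.IsRegular P)
    (Ch : ∀ X' : Scheme.{0}, (X' ⟶ P) → Set X' → Prop)
    (hChain : ∀ (X' : Scheme.{0}) (σ : X' ⟶ P) (S : Set X'), Ch X' σ S → Chain P Y X' σ S)
    (hStep : ∀ (X' X'' : Scheme.{0}) (σ' : X' ⟶ P) (S' : Set X') (C : X'.IdealSheafData) (τ : X'' ⟶ X'),
      Ch X' σ' S' → IsBlowup τ C → Scheme.IsRegular C.subscheme → Flat (C.subschemeι ≫ σ' ≫ q) →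
      σ' '' (C.support : Set X') ⊆ {x : P | ¬ IsGenericPoint x Y} →
      (C.support : Set X') ∩ (σ' ≫ q) ⁻¹' {closedPoint O} ⊆ S' →
      Ch X'' (τ ≫ σ') (closure (τ ⁻¹' (S' \ (C.support : Set X')))))
    (Ruled : Tower.RuledDatum P) (F₉ : Scheme.{0}) (Z₉ : Set F₉) (hZ₉ : IsClosed Z₉) (F₁₀ : Scheme.{0}) (υ' : F₁₀ ⟶ F₉)
    (hRuled : ∀ (G₀ G₀' : Scheme.{0}) (γ₀ : G₀ ⟶ F₁₀) (E₀ : Set G₀) (X₀ X₀'' : Scheme.{0}) (σ₀ : X₀ ⟶ P) (j₀ : G₀ ⟶ X₀)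
        (j₀' : G₀' ⟶ X₀'') (t₀' : G₀' ⟶ Spec (.of k)) (𝓔₀ : X₀.IdealSheafData) (τ₀ : X₀'' ⟶ X₀) (υ₀ : G₀' ⟶ G₀) (y₀ : G₀),
      j₀' ≫ τ₀ = υ₀ ≫ j₀ → IsPullback j₀' t₀' ((τ₀ ≫ σ₀) ≫ q) (Spec.map (CommRingCat.ofHom θ)) → y₀ ∉ E₀ →
      (∃ e : (𝓔₀.comap τ₀).subscheme ≅ 𝓔₀.subscheme, e.hom ≫ 𝓔₀.subschemeι = (𝓔₀.comap τ₀).subschemeι ≫ τ₀) →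
      Ruled F₉ Z₉ hZ₉ F₁₀ υ' G₀ γ₀ E₀ X₀ σ₀ j₀ 𝓔₀ →
      Ruled F₉ Z₉ hZ₉ F₁₀ υ' G₀' (υ₀ ≫ γ₀) (closure (υ₀ ⁻¹' (E₀ \ {y₀}))) X₀'' (τ₀ ≫ σ₀) j₀' (𝓔₀.comap τ₀)) :
    TowerPtReg₂ F₉ F₁₀ υ' (Tower.Inv₃ O k θ P q Y Ch Ruled F₉ Z₉ hZ₉ F₁₀ υ') := by
  intro G G' γ T E K y υ₂ hyc K' E' hinv hTreg hGreg hυ₂ hK' hE'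
  -- the (pt-reg) stage step: a section through `jG y` (K3), its kernel blown up (K3″), and the inputs of the centre-agnostic lemmas
  obtain ⟨X, σ, jG, C, X'', τ, j₂, t₂, hυ', hZ₉inf, hGint, hTirr, hEcl, hTE, hExc, hyc', hTy, hGnoeth, hXnoeth, hnoeth'', hτ, hdisj,
      hcomm, hCh'', hint'', hreg'', hdom'', hsq₂, hsets, hG'int, hT'irr⟩ :
      ∃ (X : Scheme.{0}) (σ : X ⟶ P) (jG : G ⟶ X) (C : X.IdealSheafData) (X'' : Scheme.{0}) (τ : X'' ⟶ X)
      (j₂ : G' ⟶ X'') (t₂ : G' ⟶ Spec (.of k)),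
      IsBlowup υ' (vanishingIdeal (⟨Z₉, hZ₉⟩ : Closeds F₉)) ∧ Z₉.Infinite ∧ IsIntegral G ∧ IsIrreducible T ∧ IsClosed E ∧ ¬ T ⊆ E ∧
      (∀ hE : IsClosed E, Tower.Exc₃ O P q Y Ruled Z₉ hZ₉ υ' G γ E hE K X σ jG) ∧
      IsClosed ({curvePt G T y} : Set G) ∧ ¬ T ⊆ {curvePt G T y} ∧ IsLocallyNoetherian G ∧ IsLocallyNoetherian X ∧
      IsLocallyNoetherian X'' ∧ IsBlowup τ C ∧
      (∀ I : X.IdealSheafData, jG (curvePt G T y) ∉ (I.support : Set X) → Disjoint (I.support : Set X) (C.support : Set X)) ∧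
      j₂ ≫ τ = υ₂ ≫ jG ∧ Ch X'' (τ ≫ σ) (closure (τ ⁻¹' ((jG '' T) \ (C.support : Set X)))) ∧ IsIntegral X'' ∧
      Scheme.IsRegular X'' ∧ IsDominant ((τ ≫ σ) ≫ q) ∧ IsPullback j₂ t₂ ((τ ≫ σ) ≫ q) (Spec.map (CommRingCat.ofHom θ)) ∧
      j₂ '' closure (υ₂ ⁻¹' (T \ {curvePt G T y})) = closure (τ ⁻¹' ((jG '' T) \ (C.support : Set X))) ∧ IsIntegral G' ∧
      IsIrreducible (closure (υ₂ ⁻¹' (T \ {curvePt G T y}))) := by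
      classical
      obtain ⟨hυ', hZ₉inf, hGint, hTcl, hTirr, hEcl, hTE, X, σ, S, jG, tG, hCh, hXint, hXnoeth, hXreg, hdom, hsq, hTS, hExc⟩ := hinv
      haveI := hGint
      haveI := hXint
      haveI := hXnoeth
      have hyT : curvePt G T y ∈ T := subschemeι_mem_of_isClosed hTcl y
      have hTy : ¬ T ⊆ {curvePt G T y} := not_subset_singleton_of_not_isRegularLocalRing_stalk y hTreg hyc
      obtain ⟨-, -, hσ⟩ := chain_isRegular P Y X σ S (hChain _ _ _ hCh) hPnoeth hPreg
      haveI := hσ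
      haveI hproper : IsProper (σ ≫ q) := inferInstance
      haveI : IsClosedImmersion (Spec.map (CommRingCat.ofHom θ)) := IsClosedImmersion.spec_of_surjective _ hθ
      haveI hjci : IsClosedImmersion jG := MorphismProperty.IsStableUnderBaseChange.of_isPullback hsq.flip inferInstance
      have hjyc : IsClosed ({jG (curvePt G T y)} : Set X) := by
        simpa only [Set.image_singleton] using hjci.isClosedEmbedding.isClosedMap _ hyc
      have hyoff : ¬ IsGenericPoint (σ (jG (curvePt G T y))) Y :=
        not_isGenericPoint_of_image_eq (hChain _ _ _ hCh) jG hjci.isClosedEmbedding.injective hTS hjyc hTy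
      have hjsp : (σ ≫ q) (jG (curvePt G T y)) = closedPoint O := by
        have h1 : jG (curvePt G T y) ∈ Set.range jG := ⟨_, rfl⟩
        rw [range_eq_preimage_of_isPullback hsq, range_specMap_of_surjective_of_field θ hθ] at h1
        exact h1
      haveI : IsLocallyNoetherian G := LocallyOfFiniteType.isLocallyNoetherian jG
      -- the section through `jG y` and the blow-up of its kernel (K3), then the model step with this section (K3″)
      obtain ⟨-, s, X'', τ, -, -, -, hs, hss₀, -, hτ, -, -, hnoeth'', -⟩ :=
        modelPointStep O k θ hθ P q Y hYsp Ch hStep X σ S hCh hXreg hproper hdom G jG tG hsq T hTS (curvePt G T y) hyc hGreg hyT hTy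
          hyoff G' υ₂ hυ₂
      haveI := hnoeth''
      obtain ⟨hCh'', hreg'', -, hint'', hdom'', hG'int, hT'irr, -, -, -, -, j₂, t₂, hsq₂, hcomm, -, hsets⟩ :=
        modelPointStep_of_section O k θ hθ P q Y hYsp hYirr hYcl Ch hChain hStep X σ S hCh hXreg hdom G jG tG hsq T hTS (curvePt G T y)
          hyc hyT hTy hyoff s hs hss₀ X'' τ hτ G' υ₂ hυ₂
      -- the centre meets the special fibre in `jG y` only
      obtain ⟨_, -, -, hCsupp⟩ := section_isClosedImmersion_and_isRegular_ker O X (σ ≫ q) s hs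
      have hCb : (s.ker.support : Set X) ∩ (σ ≫ q) ⁻¹' {closedPoint O} = {jG (curvePt G T y)} := by
        ext z
        constructor
        · rintro ⟨hz, hzsp⟩
          rw [hCsupp] at hz
          obtain ⟨p, rfl⟩ := hz
          have hp : p = closedPoint O := by
            have h1 : (s ≫ σ ≫ q) p = p := by rw [hs]; rfl
            rw [Scheme.Hom.comp_apply] at h1
            rw [← h1]; exact hzsp
          rw [Set.mem_singleton_iff, hp, hss₀]
        · rintro rfl
          refine ⟨?_, hjsp⟩
          rw [hCsupp, ← hss₀]; exact ⟨_, rfl⟩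
      have hdisj : ∀ I : X.IdealSheafData, jG (curvePt G T y) ∉ (I.support : Set X) →
          Disjoint (I.support : Set X) (s.ker.support : Set X) := fun I hI =>
        disjoint_support_of_inter_fibre_eq_singleton (σ ≫ q) s.ker I hCb hI
      subst hTS
      exact ⟨X, σ, jG, s.ker, X'', τ, j₂, t₂, hυ', hZ₉inf, hGint, hTirr, hEcl, hTE, hExc, hyc, hTy, inferInstance, hXnoeth, hnoeth'', hτ,
        hdisj, hcomm, hCh'', hint'', hreg'', hdom'', hsq₂, hsets, hG'int, hT'irr⟩
  haveI := hGint; haveI := hGnoeth; haveI := hXnoeth; haveI := hnoeth''; haveI := hint''; haveI := hG'int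
  have hD : ((vanishingIdeal (⟨{curvePt G T y}, hyc⟩ : Closeds G) : G.IdealSheafData).support : Set G) = {curvePt G T y} :=
    Scheme.IdealSheafData.coe_support_vanishingIdeal _
  rcases hE' with rfl | ⟨hside, rfl⟩
  · exact Tower.inv₃_pointCentre_new O k θ P q Y Ch Ruled hυ' hZ₉inf hyc' hTy hD hυ₂ hCh'' hreg'' hdom'' hsq₂ hsets hT'irr K'
  · have hE : Tower.NoRound υ' G γ E ∨ curvePt G T y ∉ E := hside
    rcases hK' with rfl | ⟨hyK, rfl⟩
    · exact Tower.inv₃_pointCentre_forget O k θ P q Y Ch Ruled hυ' hZ₉inf hTirr hEcl hTE hExc hyc' hTy hD hυ₂ hτ hdisj hcomm hCh''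
        hreg'' hdom'' hsq₂ hsets hT'irr hRuled hE
    · exact Tower.inv₃_pointCentre_transport O k θ P q Y Ch Ruled hυ' hZ₉inf hTirr hEcl hTE hExc hyc' hTy hD hυ₂ hτ hdisj hcomm hCh''
        hreg'' hdom'' hsq₂ hsets hT'irr hRuled hE (Or.inr hyK)


/-! ## At `Ruled := DirLift.Ruled`: stand-in-free -/

/-- **The (pt-ram) clause of the TOWER₄ driver at `INV₁ := Tower.Inv₃ … (DirLift.Ruled …)`, STAND-IN-FREE**: `Tower.towerPtRam₂_inv₃` (this file) with its ruled-datum transport hypothesis discharged by `DirLift.ruled_of_step_away`.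
[OURS · L1 W4.5b] toward `stub_elnat_coneTowerPointResolution` (stmt-ResolutionOfSingularities-20148 / -20038); NOT a statement of the manuscript. -/
theorem DirLift.towerPtRam₂_inv₃ (O : Type) [CommRing O] [IsDomain O] [IsDiscreteValuationRing O] [IsAdicComplete (maximalIdeal O) O]
    [IsAlgClosed (ResidueField O)] (k : Type) [Field k] (θ : O →+* k) (hθ : Function.Surjective θ)
    (P : Scheme.{0}) (q : P ⟶ Spec (.of O)) (Y : Set P) (hYsp : Y ⊆ q ⁻¹' {closedPoint O}) (hYirr : IsIrreducible Y)
    (hYcl : IsClosed Y) [IsProper q] [IsIntegral P] (hPnoeth : IsLocallyNoetherian P) (hPreg : Scheme.IsRegular P)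
    [SmoothOfRelativeDimension 3 q]
    (Ch : ∀ X' : Scheme.{0}, (X' ⟶ P) → Set X' → Prop)
    (hChain : ∀ (X' : Scheme.{0}) (σ : X' ⟶ P) (S : Set X'), Ch X' σ S → Chain P Y X' σ S)
    (hStep : ∀ (X' X'' : Scheme.{0}) (σ' : X' ⟶ P) (S' : Set X') (C : X'.IdealSheafData) (τ : X'' ⟶ X'),
      Ch X' σ' S' → IsBlowup τ C → Scheme.IsRegular C.subscheme → Flat (C.subschemeι ≫ σ' ≫ q) →
      σ' '' (C.support : Set X') ⊆ {x : P | ¬ IsGenericPoint x Y} →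
      (C.support : Set X') ∩ (σ' ≫ q) ⁻¹' {closedPoint O} ⊆ S' →
      Ch X'' (τ ≫ σ') (closure (τ ⁻¹' (S' \ (C.support : Set X')))))
    (F₉ : Scheme.{0}) (Z₉ : Set F₉) (hZ₉ : IsClosed Z₉) (F₁₀ : Scheme.{0}) (υ' : F₁₀ ⟶ F₉) :
    TowerPtRam₂ F₉ F₁₀ υ' (Tower.Inv₃ O k θ P q Y Ch (DirLift.Ruled O k θ P q Y) F₉ Z₉ hZ₉ F₁₀ υ') :=
  Tower.towerPtRam₂_inv₃ O k θ hθ P q Y hYsp hYirr hYcl hPnoeth hPreg Ch hChain hStep (DirLift.Ruled O k θ P q Y) F₉ Z₉ hZ₉ F₁₀ υ'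
    (DirLift.ruled_of_step_away O k θ P q Y F₉ Z₉ hZ₉ F₁₀ υ')


/-- **The (pt-reg) clause of the TOWER₄ driver at `INV₁ := Tower.Inv₃ … (DirLift.Ruled …)`, STAND-IN-FREE**: `Tower.towerPtReg₂_inv₃` (this file) with its ruled-datum transport hypothesis discharged by `DirLift.ruled_of_step_away`.
[OURS · L1 W4.5b] toward `stub_elnat_coneTowerPointResolution` (stmt-ResolutionOfSingularities-20148 / -20038); NOT a statement of the manuscript. -/
theorem DirLift.towerPtReg₂_inv₃ (O : Type) [CommRing O] [IsDomain O] [IsDiscreteValuationRing O] [IsAdicComplete (maximalIdeal O) O]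
    [IsAlgClosed (ResidueField O)] (k : Type) [Field k] (θ : O →+* k) (hθ : Function.Surjective θ)
    (P : Scheme.{0}) (q : P ⟶ Spec (.of O)) (Y : Set P) (hYsp : Y ⊆ q ⁻¹' {closedPoint O}) (hYirr : IsIrreducible Y)
    (hYcl : IsClosed Y) [IsProper q] (hPnoeth : IsLocallyNoetherian P) (hPreg : Scheme.IsRegular P)
    (Ch : ∀ X' : Scheme.{0}, (X' ⟶ P) → Set X' → Prop)
    (hChain : ∀ (X' : Scheme.{0}) (σ : X' ⟶ P) (S : Set X'), Ch X' σ S → Chain P Y X' σ S)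
    (hStep : ∀ (X' X'' : Scheme.{0}) (σ' : X' ⟶ P) (S' : Set X') (C : X'.IdealSheafData) (τ : X'' ⟶ X'),
      Ch X' σ' S' → IsBlowup τ C → Scheme.IsRegular C.subscheme → Flat (C.subschemeι ≫ σ' ≫ q) →
      σ' '' (C.support : Set X') ⊆ {x : P | ¬ IsGenericPoint x Y} →
      (C.support : Set X') ∩ (σ' ≫ q) ⁻¹' {closedPoint O} ⊆ S' →
      Ch X'' (τ ≫ σ') (closure (τ ⁻¹' (S' \ (C.support : Set X')))))
    (F₉ : Scheme.{0}) (Z₉ : Set F₉) (hZ₉ : IsClosed Z₉) (F₁₀ : Scheme.{0}) (υ' : F₁₀ ⟶ F₉) :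
    TowerPtReg₂ F₉ F₁₀ υ' (Tower.Inv₃ O k θ P q Y Ch (DirLift.Ruled O k θ P q Y) F₉ Z₉ hZ₉ F₁₀ υ') :=
  Tower.towerPtReg₂_inv₃ O k θ hθ P q Y hYsp hYirr hYcl hPnoeth hPreg Ch hChain hStep (DirLift.Ruled O k θ P q Y) F₉ Z₉ hZ₉ F₁₀ υ'
    (DirLift.ruled_of_step_away O k θ P q Y F₉ Z₉ hZ₉ F₁₀ υ')

end Summit.ResolutionOfSingularities.ResolutionOfSingularities.Cruxes.EquisingularLiftNat.Sections

end
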